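import Mathlib
import HarnessLib
import Summits.HubbardSuperconductivity.HubbardSuperconductivity.Theorems.KLProgrammeKLRegimeTwoVolumeTowerStepCovTelescope
import Summits.HubbardSuperconductivity.HubbardSuperconductivity.Theorems.KLProgrammeKLRegimeTwoVolumeTowerStepCovDataAt
import Summits.HubbardSuperconductivity.HubbardSuperconductivity.Theorems.KLProgrammeKLRegimeTwoVolumeTowerStepCovGram

/-!
# K3 VL child `KLRegimeVolumeLimitV17F2` (stmt-HubbardSuperconductivity-20440), located item #23 «W2-HALF-VL», part 4: THE SHALLOW-HALF DOORS ALONG THE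
# FLOW CHAIN, MODULO THE PIECES — `ScaleCovData` / `ScaleCovSecData` of `klStepCov V M β μ K_{m₀+d} k` and `TransferWtData` of
# `klTowerTransfer (b·L) M β μ K_{m₀+d} (k+1)` from the current history and per-step piece bounds along `K_i = klFlowFrameU L M β U μ i`

Cell `gate-hubbard-kl`, seat p3 (g13), lead of #23.  The generic telescope (`…TowerStepCovTelescope`, p602535) instantiated ON THE FLOW CHAIN of the coarse
volume `L`: base = p3's doors at `K_{m₀}` (`…TowerStepCovDataAt`, p602074; window `4^{m₀+2}·U ≤ 4^{2k+d}` at `m₀` only), Gram constant and entry sup at the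
last frame window-free (`…TowerStepCovGram`, p601425; `FrameOK` of `K_{m₀+d}` from the history), so that for EVERY step `k ≥ 1` — shallow or deep — the
spine's fields at `K_{m₀+d}` (the top frame when `m₀ + d = n_β + 1`) hold with the constant `base + Σ_{i<d} pieces`, the pieces being the per-step weighted
rows / columns / sectional rows of the family piece `Fam_i` and the covariance piece `Cov_i` (resp. of the re-analysis increments) along the chain — the
suppliers' bricks (spec: HOME/p3/g13/W2H-PIECES-SPEC.md, evidence on 20440):

* **`scaleCovData_klStepCov_flow_of_pieces (d₀)`** — `ScaleCovData (klStepCov V M β μ K_{m₀+d} k) Λ_w κ_k (Cα·(M/β)/Λ_{k+2} + Σ_{i<d}(φ i + ψ i)) (16·Cκ·klE0)`;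
* **`scaleCovSecData_klStepCov_flow_of_pieces (d₀)`** — `ScaleCovSecData (klStepCov V M β μ K_{m₀+d} k) Λ_w (Ce + Σ_{i<d}(φ i + ψ i))`;
* **`transferWtData_klTowerTransfer_flow_of_pieces (d₀)`** — `TransferWtData (klTowerTransfer (b·L) M β μ K_{m₀+d} (k+1)) (klBlockEquivD L b M (k+1))
  (klBlockEquivD L b M k) Λ_T (Cr + Σ_{i<d}(χ i + χ′ i) + 1)`.

Binders: those of the `_vol` doors (history up to `m₀ + d`), any lattice `V` with `klEngL₃ β U ≤ V`, `klEngM₃ β U V ≤ M`.  Everything is proved; no definitions;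
nothing asserts any stub, K3, VL or superconductivity. [cite: BenfattoGiulianiMastropietro2006, §2.7 (2.70)–(2.71a), §2.8 (2.80)–(2.81), §3 (3.2)–(3.3)]
-/

noncomputable section

namespace Summit.HubbardSuperconductivity.HubbardSuperconductivity.Theorems.TorusFourierL2

set_option linter.dupNamespace false -- summit = problem name (single-conjunct summit), D-0017

open Set Finset Literature.MathematicalPhysics.QuantumLattice Literature.MathematicalPhysics.QuantumLattice.BandSectorCounting
open Literature.MathematicalPhysics.QuantumLattice.FermiRG Literature.Probability.LatticeModels Literature.Analysis.SpecialFunctions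
open Summit.HubbardSuperconductivity.HubbardSuperconductivity.Theorems.DispersionFlow
open Summit.HubbardSuperconductivity.HubbardSuperconductivity.Theorems.KLRegimeSplit
open Summit.HubbardSuperconductivity.HubbardSuperconductivity.Theorems.KLProgrammeLegKernels
open Summit.HubbardSuperconductivity.HubbardSuperconductivity.Theorems.PerturbedFermiCurve
open Summit.HubbardSuperconductivity.HubbardSuperconductivity.Theorems.KLRegimeWick
open Summit.HubbardSuperconductivity.HubbardSuperconductivity.Theorems.EngineV8
open Summit.HubbardSuperconductivity.HubbardSuperconductivity.Theorems.TwoVolumeSource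
open Summit.HubbardSuperconductivity.HubbardSuperconductivity.Theorems.TwoVolumeDefect
open scoped Real

open Classical

set_option maxHeartbeats 1600000 in -- long statement
/-- **`ScaleCovData` of the tower's step covariance at the end of the flow chain, every `k ≥ 1`, modulo the family / covariance pieces** (see the module
docstring): base at `K_{m₀}` (`1 ≤ m₀`, `4^{m₀+2}·U ≤ 4^{2k+d₀}`), Gram / entry at `K_{m₀+d}` window-free, pieces `φ i` (family `Fam_{m₀+i}`, rows and
columns) and `ψ i` (covariance `Cov_{m₀+i}`) in the `1 + Λ_w·tnorm` currency for `i < d`.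
[cite: BenfattoGiulianiMastropietro2006, §2.8 (2.80)–(2.81), §3 (3.2)–(3.3)] -/
theorem scaleCovData_klStepCov_flow_of_pieces (dd : ℕ) :
    ∃ Cκ Cα : ℝ, 0 < Cκ ∧ 0 < Cα ∧
      ∀ (G : GeoConsts) (P : SplitConsts) (R : RenConsts) (Q : EngConsts) (cc : ℝ), P.WF → R.WF2 → 0 < cc → cc ≤ EngineV8.klEngC₃6 P R →
      ∀ μ ∈ klWindowC, ∀ U : ℝ, 0 < U → U ≤ min (EngineV8.klEngU₀3 P R cc) (1 / (R.Gfr 3 + 1)) → U ≤ EngineV8.klEngU₀4 P R cc →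
      ∀ β : ℝ, klBetaMin ≤ β → β ≤ Real.exp (cc / U ^ 2) →
      ∀ (L M : ℕ) [NeZero L] [NeZero M], EngineV8.klEngL₃ β U ≤ L → EngineV8.klEngM₃ β U L ≤ M →
      ∀ m₀ d : ℕ, 1 ≤ m₀ → m₀ + d ≤ nScales β + 1 → HistP klPredsV17F2 L M G P Q R β U μ 0 (m₀ + d) →
        ∀ (V : ℕ) [NeZero V], EngineV8.klEngL₃ β U ≤ V → EngineV8.klEngM₃ β U V ≤ M →
        ∀ k : ℕ, 1 ≤ k → k + 2 ≤ nScales β + 1 → (4 : ℝ) ^ (m₀ + 2) * U ≤ (4 : ℝ) ^ (2 * k + dd) →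
        ∀ Λw : ℝ, 0 ≤ Λw → Λw ≤ klScale klE0 (k + 2) →
        ∀ φ ψ : ℕ → ℝ,
        (∀ i < d, ∀ X : SpaceTimeIdx V M × SectorLeg (sectorCount k), ∑ Y : SpaceTimeIdx V M × SectorLeg (sectorCount k),
          ‖((sectorSubMatrix V M β (bgmFatMultiplier V M klE0 β (nambuXiCT V μ (klFlowFrameU L M β U μ (m₀ + i))) k)).transpose *
            hubbardCovSliceCT V M β μ 0 (klFlowFrameU L M β U μ (m₀ + i + 1)) (klScale klE0 (k + 2)) (klScale klE0 (k + 1)) *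
            sectorSubMatrix V M β (bgmFatMultiplier V M klE0 β (nambuXiCT V μ (klFlowFrameU L M β U μ (m₀ + i))) k) -
          (sectorSubMatrix V M β (bgmFatMultiplier V M klE0 β (nambuXiCT V μ (klFlowFrameU L M β U μ (m₀ + i + 1))) k)).transpose *
            hubbardCovSliceCT V M β μ 0 (klFlowFrameU L M β U μ (m₀ + i + 1)) (klScale klE0 (k + 2)) (klScale klE0 (k + 1)) *
            sectorSubMatrix V M β (bgmFatMultiplier V M klE0 β (nambuXiCT V μ (klFlowFrameU L M β U μ (m₀ + i + 1))) k)) X Y‖ *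
            (1 + Λw * (Torus.tnorm (X.1.2 - Y.1.2) : ℝ)) ≤ φ i) →
        (∀ i < d, ∀ Y : SpaceTimeIdx V M × SectorLeg (sectorCount k), ∑ X : SpaceTimeIdx V M × SectorLeg (sectorCount k),
          ‖((sectorSubMatrix V M β (bgmFatMultiplier V M klE0 β (nambuXiCT V μ (klFlowFrameU L M β U μ (m₀ + i))) k)).transpose *
            hubbardCovSliceCT V M β μ 0 (klFlowFrameU L M β U μ (m₀ + i + 1)) (klScale klE0 (k + 2)) (klScale klE0 (k + 1)) *
            sectorSubMatrix V M β (bgmFatMultiplier V M klE0 β (nambuXiCT V μ (klFlowFrameU L M β U μ (m₀ + i))) k) -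
          (sectorSubMatrix V M β (bgmFatMultiplier V M klE0 β (nambuXiCT V μ (klFlowFrameU L M β U μ (m₀ + i + 1))) k)).transpose *
            hubbardCovSliceCT V M β μ 0 (klFlowFrameU L M β U μ (m₀ + i + 1)) (klScale klE0 (k + 2)) (klScale klE0 (k + 1)) *
            sectorSubMatrix V M β (bgmFatMultiplier V M klE0 β (nambuXiCT V μ (klFlowFrameU L M β U μ (m₀ + i + 1))) k)) X Y‖ *
            (1 + Λw * (Torus.tnorm (X.1.2 - Y.1.2) : ℝ)) ≤ φ i) →
        (∀ i < d, ∀ X : SpaceTimeIdx V M × SectorLeg (sectorCount k), ∑ Y : SpaceTimeIdx V M × SectorLeg (sectorCount k),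
          ‖((sectorSubMatrix V M β (bgmFatMultiplier V M klE0 β (nambuXiCT V μ (klFlowFrameU L M β U μ (m₀ + i))) k)).transpose *
          (hubbardCovSliceCT V M β μ 0 (klFlowFrameU L M β U μ (m₀ + i + 1)) (klScale klE0 (k + 2)) (klScale klE0 (k + 1)) -
            hubbardCovSliceCT V M β μ 0 (klFlowFrameU L M β U μ (m₀ + i)) (klScale klE0 (k + 2)) (klScale klE0 (k + 1))) *
          sectorSubMatrix V M β (bgmFatMultiplier V M klE0 β (nambuXiCT V μ (klFlowFrameU L M β U μ (m₀ + i))) k)) X Y‖ *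
            (1 + Λw * (Torus.tnorm (X.1.2 - Y.1.2) : ℝ)) ≤ ψ i) →
        (∀ i < d, ∀ Y : SpaceTimeIdx V M × SectorLeg (sectorCount k), ∑ X : SpaceTimeIdx V M × SectorLeg (sectorCount k),
          ‖((sectorSubMatrix V M β (bgmFatMultiplier V M klE0 β (nambuXiCT V μ (klFlowFrameU L M β U μ (m₀ + i))) k)).transpose *
          (hubbardCovSliceCT V M β μ 0 (klFlowFrameU L M β U μ (m₀ + i + 1)) (klScale klE0 (k + 2)) (klScale klE0 (k + 1)) -
            hubbardCovSliceCT V M β μ 0 (klFlowFrameU L M β U μ (m₀ + i)) (klScale klE0 (k + 2)) (klScale klE0 (k + 1))) *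
          sectorSubMatrix V M β (bgmFatMultiplier V M klE0 β (nambuXiCT V μ (klFlowFrameU L M β U μ (m₀ + i))) k)) X Y‖ *
            (1 + Λw * (Torus.tnorm (X.1.2 - Y.1.2) : ℝ)) ≤ ψ i) →
          ScaleCovData (klStepCov V M β μ (klFlowFrameU L M β U μ (m₀ + d)) k) Λw
            (Real.sqrt (Cκ * (klScale klE0 k / klScale klE0 (k + 2)) * (klE0 * ((8 : ℝ) ^ k)⁻¹)))
            (Cα * ((M : ℝ) / β) / klScale klE0 (k + 2) + ∑ i ∈ range d, (φ i + ψ i)) (16 * Cκ * klE0) := by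
  obtain ⟨Cκb, Cαb, Ceb, hCκb, hCαb, hCeb, hbase⟩ := scaleCovData_klStepCov_klEng_flow_deep_vol_at dd
  obtain ⟨Cκ, hCκ, hgram⟩ := gram_entry_klStepCov_klEng
  refine ⟨Cκ, Cαb, hCκ, hCαb, ?_⟩
  intro G P R Q cc hP hR2 hcc hcc6 μ hμ U hU hUle hU4 β hβmin hβc L M _ _ hL3 hM3 m₀ d hm1 hN hhist V _ hV3 hVM3 k hk hkN hwin Λw hΛw0 hΛwle
    φ ψ hFrow hFcol hCrow hCcol
  have he : (0 : ℝ) < klE0 := by norm_num [klE0]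
  -- the base bundle at `K_{m₀}`
  have hb := hbase G P R Q cc hP hR2 hcc hcc6 μ hμ U hU hUle hU4 β hβmin hβc L M hL3 hM3 (m₀ + d) hN hhist m₀ hm1 (Nat.le_add_right m₀ d) V hV3 hVM3
    k hk hkN hwin Λw hΛw0 hΛwle
  -- the window-free Gram constant and entry sup at `K_{m₀+d}`
  have hfr : FrameOK R U (nScales β) μ (klFlowFrameU L M β U μ (m₀ + d)) :=
    frameOK_klFlowFrameU_of_histP_le hR2 (le_trans hm1 (Nat.le_add_right m₀ d)) le_rfl hN hhist
  obtain ⟨hent, hgr⟩ := hgram P R cc hP hR2 hcc (hcc6.trans (EngineV8.klEngC₃6_le_klEngC₃3 P R)) μ hμ U hU hU4 β hβmin hβc _ hfr V M hV3 hVM3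
    k hk (by omega)
  have h16 : klScale klE0 k / klScale klE0 (k + 2) = 16 := klScale_div_klScale_add_two k
  have hent' : ∀ Y Y' : SpaceTimeIdx V M × SectorLeg (sectorCount k), ‖klStepCov V M β μ (klFlowFrameU L M β U μ (m₀ + d)) k Y Y'‖ ≤ 16 * Cκ * klE0 := fun Y Y' => by
    refine (hent Y Y').trans ?_
    rw [h16]
    have h8 : ((8 : ℝ) ^ k)⁻¹ ≤ 1 := inv_le_one_of_one_le₀ (one_le_pow₀ (by norm_num))
    calc Cκ * 16 * (klE0 * ((8 : ℝ) ^ k)⁻¹) = 16 * Cκ * klE0 * ((8 : ℝ) ^ k)⁻¹ := by ring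
      _ ≤ 16 * Cκ * klE0 * 1 := mul_le_mul_of_nonneg_left h8 (by positivity)
      _ = 16 * Cκ * klE0 := mul_one _
  exact scaleCovData_klStepCov_of_frame_telescope β μ (fun i => klFlowFrameU L M β U μ i) k m₀ d hΛw0 hb (by positivity) hgr (by positivity) hent'
    φ ψ hFrow hFcol hCrow hCcol

set_option maxHeartbeats 1600000 in -- long statement
/-- **`ScaleCovSecData` of the tower's step covariance at the end of the flow chain, every `k ≥ 1`, modulo the SECTIONAL family / covariance pieces**
(`φ i`, `ψ i`: ε-free fixed-time inputs, `…TowerStepCovSectionalPieces`). [cite: BenfattoGiulianiMastropietro2006, §2.8 (2.81), §3 (3.3)] -/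
theorem scaleCovSecData_klStepCov_flow_of_pieces (dd : ℕ) :
    ∃ Ce : ℝ, 0 < Ce ∧
      ∀ (G : GeoConsts) (P : SplitConsts) (R : RenConsts) (Q : EngConsts) (cc : ℝ), R.WF2 → 0 < cc → cc ≤ EngineV8.klEngC₃6 P R →
      ∀ μ ∈ klWindowC, ∀ U : ℝ, 0 < U → U ≤ min (EngineV8.klEngU₀3 P R cc) (1 / (R.Gfr 3 + 1)) →
      ∀ β : ℝ, klBetaMin ≤ β → β ≤ Real.exp (cc / U ^ 2) →
      ∀ (L M : ℕ) [NeZero L] [NeZero M], EngineV8.klEngL₃ β U ≤ L → EngineV8.klEngM₃ β U L ≤ M →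
      ∀ m₀ d : ℕ, 1 ≤ m₀ → m₀ + d ≤ nScales β + 1 → HistP klPredsV17F2 L M G P Q R β U μ 0 (m₀ + d) →
        ∀ (V : ℕ) [NeZero V], EngineV8.klEngL₃ β U ≤ V →
        ∀ k : ℕ, 1 ≤ k → k + 2 ≤ nScales β + 1 → (4 : ℝ) ^ (m₀ + 2) * U ≤ (4 : ℝ) ^ (2 * k + dd) →
        ∀ Λw : ℝ, 0 ≤ Λw → Λw ≤ klScale klE0 (k + 2) →
        ∀ φ ψ : ℕ → ℝ,
        (∀ i < d, ∀ (X : SpaceTimeIdx V M × SectorLeg (sectorCount k)) (t : ImagTimeIdx M) (ℓ : SectorLeg (sectorCount k)), ∑ y : TorusSite 2 V,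
          ‖((sectorSubMatrix V M β (bgmFatMultiplier V M klE0 β (nambuXiCT V μ (klFlowFrameU L M β U μ (m₀ + i))) k)).transpose *
            hubbardCovSliceCT V M β μ 0 (klFlowFrameU L M β U μ (m₀ + i + 1)) (klScale klE0 (k + 2)) (klScale klE0 (k + 1)) *
            sectorSubMatrix V M β (bgmFatMultiplier V M klE0 β (nambuXiCT V μ (klFlowFrameU L M β U μ (m₀ + i))) k) -
          (sectorSubMatrix V M β (bgmFatMultiplier V M klE0 β (nambuXiCT V μ (klFlowFrameU L M β U μ (m₀ + i + 1))) k)).transpose *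
            hubbardCovSliceCT V M β μ 0 (klFlowFrameU L M β U μ (m₀ + i + 1)) (klScale klE0 (k + 2)) (klScale klE0 (k + 1)) *
            sectorSubMatrix V M β (bgmFatMultiplier V M klE0 β (nambuXiCT V μ (klFlowFrameU L M β U μ (m₀ + i + 1))) k)) X ((t, y), ℓ)‖ *
            (1 + Λw * (Torus.tnorm (X.1.2 - y) : ℝ)) ≤ φ i) →
        (∀ i < d, ∀ (X : SpaceTimeIdx V M × SectorLeg (sectorCount k)) (t : ImagTimeIdx M) (ℓ : SectorLeg (sectorCount k)), ∑ y : TorusSite 2 V,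
          ‖((sectorSubMatrix V M β (bgmFatMultiplier V M klE0 β (nambuXiCT V μ (klFlowFrameU L M β U μ (m₀ + i))) k)).transpose *
          (hubbardCovSliceCT V M β μ 0 (klFlowFrameU L M β U μ (m₀ + i + 1)) (klScale klE0 (k + 2)) (klScale klE0 (k + 1)) -
            hubbardCovSliceCT V M β μ 0 (klFlowFrameU L M β U μ (m₀ + i)) (klScale klE0 (k + 2)) (klScale klE0 (k + 1))) *
          sectorSubMatrix V M β (bgmFatMultiplier V M klE0 β (nambuXiCT V μ (klFlowFrameU L M β U μ (m₀ + i))) k)) X ((t, y), ℓ)‖ *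
            (1 + Λw * (Torus.tnorm (X.1.2 - y) : ℝ)) ≤ ψ i) →
          ScaleCovSecData (klStepCov V M β μ (klFlowFrameU L M β U μ (m₀ + d)) k) Λw (Ce + ∑ i ∈ range d, (φ i + ψ i)) := by
  obtain ⟨Ce, hCe, hbase⟩ := scaleCovSecData_klStepCov_klEng_flow_deep_vol_at dd
  refine ⟨Ce, hCe, ?_⟩
  intro G P R Q cc hR2 hcc hcc6 μ hμ U hU hUle β hβmin hβc L M _ _ hL3 hM3 m₀ d hm1 hN hhist V _ hV3 k hk hkN hwin Λw hΛw0 hΛwle φ ψ hFsec hCsec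
  have hb := hbase G P R Q cc hR2 hcc hcc6 μ hμ U hU hUle β hβmin hβc L M hL3 hM3 (m₀ + d) hN hhist m₀ hm1 (Nat.le_add_right m₀ d) V hV3
    k hk hkN hwin Λw hΛw0 hΛwle
  exact scaleCovSecData_klStepCov_of_frame_telescope β μ (fun i => klFlowFrameU L M β U μ i) k m₀ d hΛw0 hb φ ψ hFsec hCsec

set_option maxHeartbeats 1600000 in -- long statement
/-- **`TransferWtData` of the tower's transfer `klTowerTransfer (b·L) … K_{m₀+d} (k+1)` at the end of the flow chain, modulo the re-analysis increment
pieces**: base rows / columns at `K_{m₀}` (`k + 1 ≤ m₀`, window `4^{m₀}·U ≤ 4^{2(k+1)+d₀}`), pieces `χ i` / `χ′ i` = `klScaleWt (k+1)`-weighted rows / columns of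
`klReanalysis[K_{m₀+i+1}] k − klReanalysis[K_{m₀+i}] k` on the fine lattice `b·L` («W2H-OVL»), every `0 ≤ Λ_T ≤ Λ_{k+1}`.
[cite: BenfattoGiulianiMastropietro2006, §2.7 (2.70)–(2.71a), §3 (3.2)–(3.8)] -/
theorem transferWtData_klTowerTransfer_flow_of_pieces (dd : ℕ) :
    ∃ Cr : ℝ, 0 < Cr ∧
      ∀ (G : GeoConsts) (P : SplitConsts) (R : RenConsts) (Q : EngConsts) (cc : ℝ), R.WF2 → 0 < cc → cc ≤ EngineV8.klEngC₃6 P R →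
      ∀ μ ∈ klWindowC, ∀ U : ℝ, 0 < U → U ≤ min (EngineV8.klEngU₀3 P R cc) (1 / (R.Gfr 3 + 1)) →
      ∀ β : ℝ, klBetaMin ≤ β → β ≤ Real.exp (cc / U ^ 2) →
      ∀ (L M : ℕ) [NeZero L] [NeZero M], EngineV8.klEngL₃ β U ≤ L → EngineV8.klEngM₃ β U L ≤ M →
      ∀ m₀ d : ℕ, 1 ≤ m₀ → m₀ + d ≤ nScales β + 1 → HistP klPredsV17F2 L M G P Q R β U μ 0 (m₀ + d) →
        ∀ (b : ℕ) [NeZero (b * L)], EngineV8.klEngL₃ β U ≤ b * L →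
        ∀ k : ℕ, k + 1 ≤ m₀ → (4 : ℝ) ^ m₀ * U ≤ (4 : ℝ) ^ (2 * (k + 1) + dd) →
        ∀ ΛT : ℝ, 0 ≤ ΛT → ΛT ≤ klScale klE0 (k + 1) →
        ∀ χ χ' : ℕ → ℝ,
        (∀ i < d, ∀ X'' : SpaceTimeIdx (b * L) M × SectorLeg (sectorCount (k + 1)), ∑ X' : SpaceTimeIdx (b * L) M × SectorLeg (sectorCount k),
          ‖(klReanalysis (b * L) M β μ (klFlowFrameU L M β U μ (m₀ + i + 1)) k - klReanalysis (b * L) M β μ (klFlowFrameU L M β U μ (m₀ + i)) k) X'' X'‖ *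
            EngineV8.klScaleWt (b * L) M β (k + 1) {EngineV8.latticeLegPos (2 * (2 * M)) X'', EngineV8.latticeLegPos (2 * (2 * M)) X'} ≤ χ i) →
        (∀ i < d, ∀ X' : SpaceTimeIdx (b * L) M × SectorLeg (sectorCount k), ∑ X'' : SpaceTimeIdx (b * L) M × SectorLeg (sectorCount (k + 1)),
          ‖(klReanalysis (b * L) M β μ (klFlowFrameU L M β U μ (m₀ + i + 1)) k - klReanalysis (b * L) M β μ (klFlowFrameU L M β U μ (m₀ + i)) k) X'' X'‖ *
            EngineV8.klScaleWt (b * L) M β (k + 1) {EngineV8.latticeLegPos (2 * (2 * M)) X'', EngineV8.latticeLegPos (2 * (2 * M)) X'} ≤ χ' i) →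
          TransferWtData (klTowerTransfer (b * L) M β μ (klFlowFrameU L M β U μ (m₀ + d)) (k + 1))
            (klBlockEquivD L b M (k + 1)) (klBlockEquivD L b M k) ΛT (Cr + ∑ i ∈ range d, (χ i + χ' i) + 1) := by
  obtain ⟨Cr, hCr, hbase⟩ := rowColSumWt_klReanalysis_klEng_flow_deep_vol_at dd
  refine ⟨Cr, hCr, ?_⟩
  intro G P R Q cc hR2 hcc hcc6 μ hμ U hU hUle β hβmin hβc L M _ _ hL3 hM3 m₀ d hm1 hN hhist b _ hV3 k hkm hwin ΛT hΛT0 hΛTle χ χ' hrow hcol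
  have hβ0 : 0 < β := KLRegimeSplit.pos_of_klBetaMin_le hβmin
  obtain ⟨hbrow, hbcol⟩ := hbase G P R Q cc hR2 hcc hcc6 μ hμ U hU hUle β hβmin hβc L M hL3 hM3 (m₀ + d) hN hhist m₀ hm1 (Nat.le_add_right m₀ d)
    (b * L) hV3 k hkm hwin
  rw [klTowerTransfer_succ]
  exact transferWtData_klSrcTransfer_of_frame_telescope hβ0 μ (fun i => klFlowFrameU L M β U μ i) k m₀ d hCr.le hΛT0 hΛTle hbrow hbcol χ χ' hrow hcol

end Summit.HubbardSuperconductivity.HubbardSuperconductivity.Theorems.TorusFourierL2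

end
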